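import Summits.AtomisticToContinuum.Crystallization.Theorems.PerronTransitivityUniformBindingRigidityCohesionB
import Summits.AtomisticToContinuum.Crystallization.Theorems.ChargedEnergyGap.Negative.Unconditional

/-!
# Negative knowledge for crux `PerronTransitivity.UniformBindingRigidity` (stmt-AtomisticToContinuum-15099), III:
# the level `2E*` is the GLOBAL minimax floor — it cannot be lowered for any uniformly discrete set

Refuter vetting (crux disprover, `--supports stmt-AtomisticToContinuum-15099`).  The crux M* asks that a
non-empty uniformly discrete `X ⊆ ℝ³` with ALL Lennard-Jones site sums
`U_X(p) = ∑'_{q ∈ X, q ≠ p} V_LJ(dist p q) ≤ 2E*` (`E* = ⨅_Q e_LJ(Q) = eStar`) be a periodic minimiser.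
Part II (`PeriodicCeiling`) showed that inside the PERIODIC class no configuration is uniformly bound
strictly below `2E*`.  Here this is extended to EVERY uniformly discrete set:

* `exists_site_gt_of_lt` — **minimax floor**: for every non-empty uniformly discrete `X ⊆ ℝ³` and every
  level `ℓ < 2E*` some site has `ℓ < U_X(p)`; i.e. `sup_{p ∈ X} U_X(p) ≥ 2E*` for all such `X`.
* `not_uniformly_bound_below` — equivalently, NO non-empty uniformly discrete `X` has all its site sums
  `≤ ℓ` for any `ℓ < 2E*`: the variant of M* with a lowered level is VACUOUSLY true, and the hypothesis
  class of M* (level exactly `2E*`) consists of the minimisers of the minimax functional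
  `X ↦ sup_p U_X(p)` over all uniformly discrete sets — if that value is attained at all.  So the
  constant of the crux is sharp in the strongest sense (zero slack from below for arbitrary `X`, zero
  slack from above inside the periodic class by part II).

Proof.  If all sites are `≤ ℓ = 2E* − ε`, then `X` is `1/4`-separated (`quarter_le_dist`).  For the
finite cluster `F_R = X ∩ B̄(0,R)`: periodisation gives `|F_R|·E* ≤ E_LJ(F_R)` (tree
`card_mul_eStar_le`), i.e. `|F_R|·2E* ≤ Σ_{a ∈ F_R} Σ_{b ∈ F_R ∖ a} V(dist a b)` (`card_mul_le_sum_sum`);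
truncating each site sum to the cluster costs at most the far tail
`(1/6)·1024/((1/4)³·max(R − ‖a‖, 1/4)³)` (part II-B `sum_le_tsum_add_of_far`), which is `≤ ε/2` at
depth `≥ T` and `≤ W = 699050.67` always.  Hence `ε|F_R| ≤ (ε/2)|F_R| + W(|F_R| − |F_{R−T}|)`, i.e.
`|F_{R−T}| ≤ θ|F_R|` with `θ = 1 − ε/(2W) < 1` (`cluster_ineq`): the counting function grows at least
GEOMETRICALLY in the radius, against the cubic packing bound `|F_R| ≤ (8R+1)³` (`ncard_ball_le`) —
contradiction (`(k+1)³θᵏ → 0`).  All `[folklore]`.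
-/

noncomputable section

namespace Summit.AtomisticToContinuum.Crystallization.Theorems.UniformBindingRigidity.Negative.MinimaxFloor

open scoped BigOperators Topology
open Filter Set Metric
open Literature.MathematicalPhysics.StatisticalMechanics
open Summit.AtomisticToContinuum.Crystallization.Theorems.ChargedEnergyGapNegative
  (E3 eStar eStar_le card_mul_eStar_le)
open Summit.AtomisticToContinuum.Crystallization.Theorems.PerronTransitivityUniformBindingRigidity
  (quarter_le_dist two_mul_iInf_lt_zero finite_sep_ball sum_le_tsum_add_of_far)
open Summit.AtomisticToContinuum.Crystallization.Theorems.HullBulkOptimal (ncard_ball_le)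

/-! ## §1 The cluster energy floor in double-sum form -/

/-- **`|F|·2E* ≤ Σ_{a ∈ F} Σ_{b ∈ F ∖ {a}} V_LJ(dist a b)`** for every finite `F ⊆ ℝ³` (the tree's
periodisation bound `N·E* ≤ E_LJ` on an enumeration of `F`, rewritten through `2E = Σᵢ Σₖ V`,
`V_LJ(0) = 0`). [folklore] -/
theorem card_mul_le_sum_sum (F : Finset E3) :
    (F.card : ℝ) * (2 * eStar) ≤ ∑ a ∈ F, ∑ b ∈ F.erase a, lennardJones (dist a b) := by
  classical
  set n : ℕ := F.card with hn
  set e := F.equivFin with he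
  set x : Fin n → E3 := fun i => (e.symm i).1 with hx
  have hxinj : Function.Injective x := fun i j h => e.symm.injective (Subtype.ext h)
  have h1 : (n : ℝ) * eStar ≤ interactionEnergy lennardJones x := card_mul_eStar_le hxinj
  have h2 : 2 * interactionEnergy lennardJones x = ∑ i, ∑ k, lennardJones (dist (x i) (x k)) :=
    two_mul_interactionEnergy_eq_sum_sum lennardJones lennardJones_zero x
  have inner : ∀ p : E3, ∑ k, lennardJones (dist p (x k)) = ∑ b ∈ F, lennardJones (dist p b) := by
    intro p
    calc ∑ k : Fin n, lennardJones (dist p (x k))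
        = ∑ b : {a // a ∈ F}, lennardJones (dist p b.1) :=
          Equiv.sum_comp e.symm (fun b : {a // a ∈ F} => lennardJones (dist p b.1))
      _ = ∑ b ∈ F, lennardJones (dist p b) := Finset.sum_coe_sort F (fun b => lennardJones (dist p b))
  have h3 : ∑ i, ∑ k, lennardJones (dist (x i) (x k)) = ∑ a ∈ F, ∑ b ∈ F, lennardJones (dist a b) := by
    simp_rw [inner]
    calc ∑ i : Fin n, ∑ b ∈ F, lennardJones (dist (x i) b)
        = ∑ a : {a // a ∈ F}, ∑ b ∈ F, lennardJones (dist a.1 b) :=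
          Equiv.sum_comp e.symm (fun a : {a // a ∈ F} => ∑ b ∈ F, lennardJones (dist a.1 b))
      _ = ∑ a ∈ F, ∑ b ∈ F, lennardJones (dist a b) :=
          Finset.sum_coe_sort F (fun a => ∑ b ∈ F, lennardJones (dist a b))
  have h4 : ∀ a ∈ F, ∑ b ∈ F, lennardJones (dist a b) = ∑ b ∈ F.erase a, lennardJones (dist a b) := by
    intro a ha
    rw [← Finset.add_sum_erase F _ ha, dist_self, lennardJones_zero, zero_add]
  rw [Finset.sum_congr rfl h4] at h3
  calc (n : ℝ) * (2 * eStar) = 2 * ((n : ℝ) * eStar) := by ring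
    _ ≤ 2 * interactionEnergy lennardJones x := by linarith
    _ = ∑ a ∈ F, ∑ b ∈ F.erase a, lennardJones (dist a b) := by rw [h2, h3]

/-! ## §2 Truncating a site sum to a ball costs at most the far tail -/

/-- For a `1/4`-separated `X`, the cluster `F = X ∩ B̄(0,R)` and `a ∈ F`:
`Σ_{b ∈ F ∖ a} V(dist a b) ≤ U_X(a) + (1/6)·1024/((1/4)³·max(R − ‖a‖, 1/4)³)` — the dropped points lie
outside `B̄(0,R)`, at distance `≥ max(R − ‖a‖, 1/4)` from `a`. [folklore] -/
theorem sum_erase_le_tsum_add_max {X : Set E3}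
    (hsep : ∀ p ∈ X, ∀ q ∈ X, p ≠ q → 1 / 4 ≤ dist p q) {R : ℝ} (F : Finset E3)
    (hF : ∀ a, a ∈ F ↔ a ∈ X ∧ dist a 0 ≤ R) {a : E3} (ha : a ∈ F) :
    ∑ b ∈ F.erase a, lennardJones (dist a b) ≤
      ∑' b : {b : E3 // b ∈ X ∧ b ≠ a}, lennardJones (dist a b.1) +
        1 / 6 * (1024 / ((1 / 4 : ℝ) ^ 3 * (max (R - dist a 0) (1 / 4)) ^ 3)) := by
  refine sum_le_tsum_add_of_far (by norm_num) hsep a (le_max_right _ _) (F.erase a)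
    (fun b hb => ?_) ?_
  · obtain ⟨hba, hbF⟩ := Finset.mem_erase.1 hb
    exact ⟨((hF b).1 hbF).1, hba⟩
  · intro b hb hba hbI
    have hbF : b ∉ F := fun h => hbI (Finset.mem_erase.2 ⟨hba, h⟩)
    rw [hF] at hbF
    have hRb : R < dist b 0 := by
      by_contra h
      exact hbF ⟨hb, not_lt.1 h⟩
    refine max_le ?_ (hsep b hb a ((hF a).1 ha).1 hba)
    have := dist_triangle b a 0
    linarith

/-! ## §3 The cluster inequality: inner balls carry at most a fraction `θ < 1` of the points -/

/-- **Cluster inequality.** If every site of a `1/4`-separated `X` is bound `≤ ℓ`, then for the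
clusters `F = X ∩ B̄(0,R)` ⊇ `F' = X ∩ B̄(0,R−T)` (`T ≥ 1/4`):
`|F|·(2E* − ℓ) ≤ |F|·(1/6)·1024/((1/4)³T³) + (|F| − |F'|)·(1/6)·1024·4⁶`. [folklore] -/
theorem cluster_ineq {X : Set E3}
    (hsep : ∀ p ∈ X, ∀ q ∈ X, p ≠ q → 1 / 4 ≤ dist p q) {ℓ : ℝ}
    (hB : ∀ p ∈ X, ∑' q : {q : E3 // q ∈ X ∧ q ≠ p}, lennardJones (dist p q.1) ≤ ℓ)
    {R T : ℝ} (hT : 1 / 4 ≤ T) (F F' : Finset E3)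
    (hF : ∀ a, a ∈ F ↔ a ∈ X ∧ dist a 0 ≤ R) (hF' : ∀ a, a ∈ F' ↔ a ∈ X ∧ dist a 0 ≤ R - T) :
    (F.card : ℝ) * (2 * eStar - ℓ) ≤
      F.card * (1 / 6 * (1024 / ((1 / 4 : ℝ) ^ 3 * T ^ 3))) +
        (F.card - F'.card) * (1 / 6 * (1024 / ((1 / 4 : ℝ) ^ 3 * (1 / 4 : ℝ) ^ 3))) := by
  classical
  have hT0 : 0 < T := lt_of_lt_of_le (by norm_num) hT
  have hsub : F' ⊆ F := fun a ha => by
    rw [hF'] at ha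
    rw [hF]
    exact ⟨ha.1, by linarith [ha.2]⟩
  set τ : E3 → ℝ := fun a =>
    1 / 6 * (1024 / ((1 / 4 : ℝ) ^ 3 * (max (R - dist a 0) (1 / 4)) ^ 3)) with hτ
  set τT : ℝ := 1 / 6 * (1024 / ((1 / 4 : ℝ) ^ 3 * T ^ 3)) with hτT
  set W : ℝ := 1 / 6 * (1024 / ((1 / 4 : ℝ) ^ 3 * (1 / 4 : ℝ) ^ 3)) with hW
  have h1 := card_mul_le_sum_sum F
  have h2 : ∑ a ∈ F, ∑ b ∈ F.erase a, lennardJones (dist a b) ≤ ∑ a ∈ F, (ℓ + τ a) := by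
    refine Finset.sum_le_sum fun a ha => ?_
    have h := sum_erase_le_tsum_add_max hsep F hF ha
    have hBa := hB a ((hF a).1 ha).1
    simp only [hτ]
    linarith
  have h3 : ∑ a ∈ F, (ℓ + τ a) = F.card * ℓ + ∑ a ∈ F, τ a := by
    rw [Finset.sum_add_distrib, Finset.sum_const, nsmul_eq_mul]
  have h4 : ∑ a ∈ F, τ a = ∑ a ∈ F \ F', τ a + ∑ a ∈ F', τ a := (Finset.sum_sdiff hsub).symm
  have hτT_le : ∀ a ∈ F', τ a ≤ τT := by
    intro a ha
    rw [hF'] at ha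
    have hmax : T ≤ max (R - dist a 0) (1 / 4) := le_max_of_le_left (by linarith [ha.2])
    simp only [hτ, hτT]
    gcongr
  have hτW_le : ∀ a ∈ F \ F', τ a ≤ W := by
    intro a _
    have hmax : (1 / 4 : ℝ) ≤ max (R - dist a 0) (1 / 4) := le_max_right _ _
    simp only [hτ, hW]
    gcongr
  have h5 : ∑ a ∈ F', τ a ≤ F'.card * τT := by
    have := Finset.sum_le_sum hτT_le
    rwa [Finset.sum_const, nsmul_eq_mul] at this
  have h6 : ∑ a ∈ F \ F', τ a ≤ (F.card - F'.card) * W := by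
    have := Finset.sum_le_sum hτW_le
    rw [Finset.sum_const, nsmul_eq_mul, Finset.card_sdiff_of_subset hsub,
      Nat.cast_sub (Finset.card_le_card hsub)] at this
    exact this
  have hcard : (F'.card : ℝ) ≤ F.card := by exact_mod_cast Finset.card_le_card hsub
  have hτT0 : 0 ≤ τT := by positivity
  have h7 : (F'.card : ℝ) * τT ≤ F.card * τT := mul_le_mul_of_nonneg_right hcard hτT0
  linarith

/-! ## §4 The minimax floor -/

/-- **Minimax floor.** For every non-empty uniformly discrete `X ⊆ ℝ³` and every level `ℓ < 2E*`,
some site of `X` has Lennard-Jones site sum `> ℓ`: `sup_{p ∈ X} U_X(p) ≥ 2E*`.  Equivalently, the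
hypothesis class of M* with the level lowered to any `ℓ < 2E*` is EMPTY. [folklore] -/
theorem exists_site_gt_of_lt (X : Set E3) (hne : X.Nonempty)
    (hud : ∃ δ : ℝ, 0 < δ ∧ ∀ p ∈ X, ∀ q ∈ X, p ≠ q → δ ≤ dist p q)
    {ℓ : ℝ} (hℓ : ℓ < 2 * eStar) :
    ∃ p ∈ X, ℓ < ∑' q : {q : E3 // q ∈ X ∧ q ≠ p}, lennardJones (dist p q.1) := by
  classical
  by_contra hcon
  push Not at hcon
  -- WLOG the margin `ε = 2E* − ℓ` is at most `W`
  set W : ℝ := 1 / 6 * (1024 / ((1 / 4 : ℝ) ^ 3 * (1 / 4 : ℝ) ^ 3)) with hW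
  have hW0 : 0 < W := by positivity
  set ℓ' : ℝ := max ℓ (2 * eStar - W) with hℓ'
  have hB : ∀ p ∈ X, ∑' q : {q : E3 // q ∈ X ∧ q ≠ p}, lennardJones (dist p q.1) ≤ ℓ' :=
    fun p hp => (hcon p hp).trans (le_max_left _ _)
  have hℓ'lt : ℓ' < 2 * eStar := max_lt hℓ (by linarith)
  set ε : ℝ := 2 * eStar - ℓ' with hε
  have hε0 : 0 < ε := by linarith
  have hεW : ε ≤ W := by
    have : 2 * eStar - W ≤ ℓ' := le_max_right _ _
    linarith
  -- `X` is `1/4`-separated (all sites `≤ ℓ' < 2E* < 0`)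
  have h20 : 2 * eStar < 0 := two_mul_iInf_lt_zero
  have hsep : ∀ p ∈ X, ∀ q ∈ X, p ≠ q → 1 / 4 ≤ dist p q :=
    quarter_le_dist hud fun p hp => (hB p hp).trans (by linarith)
  have h4 : (0 : ℝ) < 1 / 4 := by norm_num
  -- the counting function of balls about `0`
  have hfin : ∀ R : ℝ, ({q : E3 | q ∈ X ∧ dist q 0 ≤ R} : Set E3).Finite :=
    fun R => finite_sep_ball h4 hsep 0 R
  set n : ℝ → ℕ := fun R => (hfin R).toFinset.card with hn
  have hmem : ∀ (R : ℝ) (a : E3), a ∈ (hfin R).toFinset ↔ a ∈ X ∧ dist a 0 ≤ R :=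
    fun R a => by rw [Set.Finite.mem_toFinset]; rfl
  -- packing bound
  have hpack : ∀ R : ℝ, 0 ≤ R → (n R : ℝ) ≤ (8 * R + 1) ^ 3 := by
    intro R hR
    have h := ncard_ball_le h4 hsep (0 : E3) hR
    rw [Set.ncard_eq_toFinset_card _ (hfin R)] at h
    rw [show (2 * R / (1 / 4) + 1 : ℝ) = 8 * R + 1 by ring] at h
    exact h
  -- the depth `T` at which the far tail is `≤ ε/2`
  set T : ℝ := max 1 (65536 / (3 * ε)) with hT
  have hT1 : 1 ≤ T := le_max_left _ _
  have hT4 : 1 / 4 ≤ T := by linarith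
  have hτT : 1 / 6 * (1024 / ((1 / 4 : ℝ) ^ 3 * T ^ 3)) ≤ ε / 2 := by
    have hT0 : 0 < T := by linarith
    have hTε : 65536 / (3 * ε) ≤ T := le_max_right _ _
    have hT3 : T ≤ T ^ 3 := by
      calc T = T * 1 * 1 := by ring
        _ ≤ T * T * T := by gcongr
        _ = T ^ 3 := by ring
    rw [show 1 / 6 * (1024 / ((1 / 4 : ℝ) ^ 3 * T ^ 3)) = 65536 / 6 / T ^ 3 by
      field_simp; ring]
    rw [div_le_iff₀ (by positivity)]
    have h3ε : 65536 ≤ T * (3 * ε) := by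
      rwa [div_le_iff₀ (by positivity)] at hTε
    nlinarith
  -- the cluster inequality gives geometric decay inwards: `n (R - T) ≤ θ · n R`
  set θ : ℝ := 1 - ε / (2 * W) with hθ
  have hθ0 : 0 ≤ θ := by
    rw [hθ, sub_nonneg, div_le_one (by positivity)]
    linarith
  have hθ1 : θ < 1 := by
    rw [hθ]
    have : 0 < ε / (2 * W) := by positivity
    linarith
  have hstep : ∀ R : ℝ, (n (R - T) : ℝ) ≤ θ * n R := by
    intro R
    have h := cluster_ineq hsep hB hT4 (hfin R).toFinset (hfin (R - T)).toFinset (hmem R)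
      (hmem (R - T))
    -- `n R · ε ≤ n R · ε/2 + (n R − n (R−T)) · W`
    have hnR : (0 : ℝ) ≤ n R := Nat.cast_nonneg _
    have h' : (n R : ℝ) * ε ≤ n R * (ε / 2) + (n R - n (R - T)) * W := by
      have := mul_le_mul_of_nonneg_left hτT hnR
      simp only [hn] at h this ⊢
      linarith
    -- rearrange
    have key : (n R : ℝ) * (ε / 2) / W ≤ n R - n (R - T) := by
      rw [div_le_iff₀ hW0]
      linarith
    have hθn : θ * n R = n R - (n R : ℝ) * (ε / 2) / W := by
      rw [hθ]
      field_simp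
    linarith
  -- iterate: `n R₀ ≤ θ^k · n (R₀ + k T)`
  have hiter : ∀ (k : ℕ) (R : ℝ), (n R : ℝ) ≤ θ ^ k * n (R + k * T) := by
    intro k
    induction k with
    | zero => intro R; simp
    | succ k ih =>
      intro R
      have h1 := ih R
      have h2 := hstep (R + (k + 1 : ℕ) * T)
      rw [show R + ((k + 1 : ℕ) : ℝ) * T - T = R + (k : ℝ) * T by push_cast; ring] at h2
      calc (n R : ℝ) ≤ θ ^ k * n (R + k * T) := h1
        _ ≤ θ ^ k * (θ * n (R + ((k + 1 : ℕ) : ℝ) * T)) :=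
            mul_le_mul_of_nonneg_left h2 (pow_nonneg hθ0 k)
        _ = θ ^ (k + 1) * n (R + ((k + 1 : ℕ) : ℝ) * T) := by ring
  -- a point of `X` and the radius through it
  obtain ⟨p₀, hp₀⟩ := hne
  set R₀ : ℝ := dist p₀ 0 with hR₀
  have hR₀0 : 0 ≤ R₀ := dist_nonneg
  have hn1 : (1 : ℝ) ≤ n R₀ := by
    have : p₀ ∈ (hfin R₀).toFinset := (hmem R₀ p₀).2 ⟨hp₀, le_rfl⟩
    exact_mod_cast Finset.card_pos.2 ⟨p₀, this⟩
  -- growth versus packing: `1 ≤ θ^k · (A (k+1))³` for all `k`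
  set A : ℝ := 8 * R₀ + 1 + 8 * T with hA
  have hA0 : 0 ≤ A := by positivity
  have hbound : ∀ k : ℕ, (1 : ℝ) ≤ A ^ 3 * (((k + 1 : ℕ) : ℝ) ^ 3 * θ ^ k) := by
    intro k
    have h1 := hiter k R₀
    have h2 := hpack (R₀ + k * T) (by positivity)
    have h3 : (8 * (R₀ + k * T) + 1 : ℝ) ≤ A * ((k + 1 : ℕ) : ℝ) := by
      rw [hA]; push_cast
      nlinarith [hR₀0, hT1, (Nat.cast_nonneg k : (0 : ℝ) ≤ k)]
    have h4 : (8 * (R₀ + k * T) + 1 : ℝ) ^ 3 ≤ (A * ((k + 1 : ℕ) : ℝ)) ^ 3 :=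
      pow_le_pow_left₀ (by positivity) h3 3
    calc (1 : ℝ) ≤ n R₀ := hn1
      _ ≤ θ ^ k * n (R₀ + k * T) := h1
      _ ≤ θ ^ k * (A * ((k + 1 : ℕ) : ℝ)) ^ 3 :=
          mul_le_mul_of_nonneg_left (h2.trans h4) (pow_nonneg hθ0 k)
      _ = A ^ 3 * (((k + 1 : ℕ) : ℝ) ^ 3 * θ ^ k) := by ring
  -- but `(k+1)³ θ^k → 0`
  have hlim : Tendsto (fun k : ℕ => A ^ 3 * (((k + 1 : ℕ) : ℝ) ^ 3 * θ ^ k)) atTop (𝓝 0) := by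
    have habs : |θ| < 1 := by rw [abs_lt]; constructor <;> linarith
    have h1 : Tendsto (fun k : ℕ => ((k : ℕ) : ℝ) ^ 3 * θ ^ k) atTop (𝓝 0) :=
      tendsto_pow_const_mul_const_pow_of_abs_lt_one 3 habs
    have h2 : Tendsto (fun k : ℕ => (((k + 1 : ℕ) : ℝ)) ^ 3 * θ ^ (k + 1)) atTop (𝓝 0) :=
      h1.comp (tendsto_add_atTop_nat 1)
    rcases eq_or_lt_of_le hθ0 with hθz | hθpos
    · -- θ = 0: the sequence is eventually 0
      refine tendsto_const_nhds.congr' ?_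
      filter_upwards [Filter.eventually_ge_atTop 1] with k hk
      rw [← hθz, zero_pow (by omega)]
      simp
    · have h3 : Tendsto (fun k : ℕ => θ⁻¹ * ((((k + 1 : ℕ) : ℝ)) ^ 3 * θ ^ (k + 1))) atTop (𝓝 0) := by
        simpa using h2.const_mul θ⁻¹
      have h4 : (fun k : ℕ => A ^ 3 * (((k + 1 : ℕ) : ℝ) ^ 3 * θ ^ k)) =
          fun k : ℕ => A ^ 3 * (θ⁻¹ * ((((k + 1 : ℕ) : ℝ)) ^ 3 * θ ^ (k + 1))) := by
        funext k
        rw [pow_succ]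
        field_simp
        ring
      rw [h4]
      simpa using h3.const_mul (A ^ 3)
  obtain ⟨k, hk⟩ := (Metric.tendsto_atTop.1 hlim (1 / 2) (by norm_num))
  have hk' := hk k le_rfl
  rw [Real.dist_eq, sub_zero, abs_lt] at hk'
  linarith [hbound k, hk'.2]

/-- **No uniformly discrete set is uniformly bound below `2E*`**: for `ℓ < 2E*` there is no non-empty
uniformly discrete `X ⊆ ℝ³` with `U_X(p) ≤ ℓ` at every site.  (So the level of M* cannot be lowered:
with any `ℓ < 2E*` in place of `2E*` its hypothesis class is empty and the statement vacuous.)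
[folklore] -/
theorem not_uniformly_bound_below {ℓ : ℝ}
    (hℓ : ℓ < 2 * ⨅ Q : PeriodicConfiguration 3, Q.energyPerParticle lennardJones) :
    ¬ ∃ X : Set (EuclideanSpace ℝ (Fin 3)), X.Nonempty ∧
        (∃ δ : ℝ, 0 < δ ∧ ∀ p ∈ X, ∀ q ∈ X, p ≠ q → δ ≤ dist p q) ∧
        ∀ p ∈ X, ∑' q : {q : EuclideanSpace ℝ (Fin 3) // q ∈ X ∧ q ≠ p},
          lennardJones (dist p q.1) ≤ ℓ := by
  rintro ⟨X, hne, hud, hB⟩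
  obtain ⟨p, hp, hlt⟩ := exists_site_gt_of_lt X hne hud hℓ
  exact absurd (hB p hp) (not_le.2 hlt)

/-- **The lowered-level variant of M* is vacuously true** (every conclusion follows), for every
`ℓ < 2E*`. [folklore] -/
theorem lowered_level_vacuous {ℓ : ℝ}
    (hℓ : ℓ < 2 * ⨅ Q : PeriodicConfiguration 3, Q.energyPerParticle lennardJones)
    (C : Set (EuclideanSpace ℝ (Fin 3)) → Prop) :
    ∀ X : Set (EuclideanSpace ℝ (Fin 3)), X.Nonempty →
      (∃ δ : ℝ, 0 < δ ∧ ∀ p ∈ X, ∀ q ∈ X, p ≠ q → δ ≤ dist p q) →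
      (∀ p ∈ X, ∑' q : {q : EuclideanSpace ℝ (Fin 3) // q ∈ X ∧ q ≠ p},
          lennardJones (dist p q.1) ≤ ℓ) → C X :=
  fun X hne hud hB => (not_uniformly_bound_below hℓ ⟨X, hne, hud, hB⟩).elim

/-- **Sup form**: every non-empty uniformly discrete `X ⊆ ℝ³` has sites bound arbitrarily close to (or
worse than) the crystal average: `∀ ε > 0, ∃ p ∈ X, 2E* − ε < U_X(p)`. [folklore] -/
theorem exists_site_gt_sub (X : Set (EuclideanSpace ℝ (Fin 3))) (hne : X.Nonempty)
    (hud : ∃ δ : ℝ, 0 < δ ∧ ∀ p ∈ X, ∀ q ∈ X, p ≠ q → δ ≤ dist p q) {ε : ℝ} (hε : 0 < ε) :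
    ∃ p ∈ X, 2 * (⨅ Q : PeriodicConfiguration 3, Q.energyPerParticle lennardJones) - ε <
      ∑' q : {q : EuclideanSpace ℝ (Fin 3) // q ∈ X ∧ q ≠ p}, lennardJones (dist p q.1) :=
  exists_site_gt_of_lt X hne hud (by change 2 * eStar - ε < 2 * eStar; linarith)

end Summit.AtomisticToContinuum.Crystallization.Theorems.UniformBindingRigidity.Negative.MinimaxFloor

end
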